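import Summits.NavierStokesRegularity.FunctionalMining.NoGo.TopBotEigSplitFloor
import HarnessLib

/-!
# FunctionalMining / NoGo — K13a: the second-difference floor of the symmetrised top–bottom core
# density for `1 ≤ q ≤ 2` and the ceiling of `‖·‖^q` for `0 < q ≤ 2` (door D-K6 (c) below two,
# finite-dimensional side, part 1 of 2)

HONEST FRAMING. Search for candidate a priori estimates; no regularity claim. Nothing about
Navier–Stokes is proved or asserted in this file: one-variable real analysis (§1) and
finite-dimensional inequalities for flat `3 × 3` tensors (§2, §3). Cell `pub-nsfunc`, no-go seat
(gen 40), kernel candidate K13 = two files K13a `NoGo/TopBotEigSplitFloorLeTwo` (this file; imports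
the tree's K10a `NoGo/TopBotEigSplitFloor`) and K13b `NoGo/TopBotEigSplittingLocal` (imports the
tree's K10c `NoGo/TopBotEigSplitting` and this file).

THE TARGET. The staged K12 `NoGo/TopBotEigHeatCoerciveLtTwo` reduced the door-(c) node
`TopBotEigHeatCoercivePos q` for real `1 < q < 2` to the finite-dimensional obligation
`TopEig.TopBotEigSplitting q c` with a share `c > 0` (K9 did so for `q > 2`, and K10 proved the
splitting for every real `q ≥ 2`). K10's FLOOR (`TopBotEigSplitFloor` §3: the tangent of the CONVEX
`s ↦ s^{q/2}` at `λ(±B)²`) needs `q ≥ 2` — below two `s^{q/2}` is concave and gives no floor. K13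
PROVES the splitting for every real `1 < q ≤ 2` (hence, with K10, for EVERY REAL `q > 1`) by a
different and again eigenvector-free mechanism: the OUTER uniform strong convexity of `t ↦ t^q` on
a bounded range, played against the `1`-Lipschitz bound and the midpoint convexity of `λ`.

WHAT IS PROVED HERE [ours] (`λ = TopEig.lam`; `f_q = TopEig.coreDensity q = λ^q + λ(−·)^q` on
symmetric trace-free tensors; `N = TopEig.normDensity q = ‖·‖^q`; `Δ²_X g(B) = g(B+X)+g(B−X)−2g(B)`):
* §1 (one variable, `1 ≤ q ≤ 2`) `convexOn_rpow_sub_sq`: `t^q − (q(q−1)/2)R^{q−2}t²` is convex on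
  `[0, R]`; `rpow_midpoint_le`: `2((s+t)/2)^q + (q(q−1)/4)R^{q−2}(s−t)² ≤ s^q + t^q` on `[0,R]²`;
  `rpow_secondDiff_ge` (+ the tangent of `t^q` at `u₀ ≤ (a+b)/2`); `rpow_secondDiff_ge_sq`:
  `(q(q−1)/6)·R^{q−2}·(a² + b² − 2u₀²) ≤ a^q + b^q − 2u₀^q` for `a, b ∈ [0, R]`, `0 < u₀ ≤ R`,
  `a + b ≥ 2u₀`, `|a − u₀|, |b − u₀| ≤ L ≤ u₀` (`a²+b²−2u₀² ≤ 3u₀D + (a−b)²/2`, `D = a+b−2u₀ ≤ 2L`).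
* §2 `lam_rpow_secondDiff_ge` (one Rayleigh branch: `u₀ = λ(B) ≥ ‖B‖/6 ≥ ‖X‖` by the tree's
  `norm_le_six_mul_lam`, `R = ‖B‖+‖X‖`, `2λ(B) ≤ λ(B+X)+λ(B−X)`, `|λ(B±X) − λ(B)| ≤ ‖X‖`), and the
  **SECOND-DIFFERENCE FLOOR `TopEig.coreDensity_secondDiff_ge_of_le_two (hq1 : 1 ≤ q)
  (hq2 : q ≤ 2) … (hB0 : B ≠ 0) (hXB : 6‖X‖ ≤ ‖B‖) : (2q(q−1)/21)·(‖B‖²)^{q/2−1}·‖X‖² ≤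
  Δ²_X f_q (B)`** for symmetric trace-free `B, X` (both branches, the tree's sum-of-squares floor
  `secondDiff_sq_sum_ge` `Δ²(λ²) + Δ²(λ(−·)²) ≥ (2/3)‖X‖²`, and `(‖B‖+‖X‖)^{q−2} ≥ (6/7)‖B‖^{q−2}`).
* §3 the **SECOND-DIFFERENCE CEILING `TopEig.normDensity_secondDiff_le_of_le_two (hq0 : 0 < q)
  (hq2 : q ≤ 2) (hB0 : B ≠ 0) (X) : Δ²_X N (B) ≤ q·(‖B‖²)^{q/2−1}·‖X‖²`** for EVERY step `X`
  (concavity of `s ↦ s^{q/2}` at `‖B±X‖²`, the parallelogram law, Bernoulli).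
The constants are not sharp (the census seats' float screens give `q(q−1)2^{(2−q)/2}/3` for the
minimal ratio `Δ²f_q/(‖B‖^{q−2}‖X‖²)`, attained at a planar `B` with a commuting push; not used).

WHAT IS NOT PROVED HERE. The convexity of `k_{q,c} = f_q − cN` composed with the trace-free part,
the gauge and the splitting itself are K13b; nothing at `q ≤ 1`; door (b) (`3/2 < q < 2`, the
`|λ₂|`-moment against the heat gain) is untouched and OPEN both ways.

PROVENANCE / STATUS. Typed and farm-checked by the no-go seat (gen 40): this file stand-alone
against the tree, K13b as the concatenation K13a+K13b under the tree import K10c (evidence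
`pub-nsfunc-nogo/sieveld/kti/`, incl. the JOINT E-check `TopBotEigHeatCoercivePos q` for EVERY
real `q > 1` from K7 / K9 / K12 and the value `shareConstLeTwo (3/2) = 1/21`); STATUS: STAGED
(`pub-nsfunc-nogo/NoGo/<name>.STAGING.lean`), filing by a prove seat on the lead's word, in the
order K13a → K13b (the planner seat cannot file under `FunctionalMining/`). Search for candidate
a priori estimates; no regularity claim. [ours; K1-Q6 (c) = door D-K6 (c), finite-dimensional
side, `1 < q ≤ 2`]
FILING (prove seat g26, REQUEST #27a): declarations byte-identical to the no-go seat's staged `TopBotEigSplitFloorLeTwo.STAGING.lean` 78c83658c22e05fb; this line is the only addition.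
-/

noncomputable section

open Finset Set Real

namespace Summit.NavierStokesRegularity.FunctionalMining

namespace TopEig

/-! ## 1. One-variable lemmas: uniform strong convexity of `t ↦ t^q` on `[0, R]`, `1 ≤ q ≤ 2` -/

/-- `t ↦ t^q − (q(q−1)/2)·R^{q−2}·t²` is convex on `[0, R]` for `1 ≤ q ≤ 2` (its second
derivative on `(0, R)` is `q(q−1)(t^{q−2} − R^{q−2}) ≥ 0`). [folklore] -/
theorem convexOn_rpow_sub_sq {q R : ℝ} (hq1 : 1 ≤ q) (hq2 : q ≤ 2) :
    ConvexOn ℝ (Icc 0 R) (fun t : ℝ => t ^ q - q * (q - 1) / 2 * R ^ (q - 2) * t ^ 2) := by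
  set κ : ℝ := q * (q - 1) / 2 * R ^ (q - 2) with hκ
  have hd1 : ∀ t : ℝ, HasDerivAt (fun t : ℝ => t ^ q - κ * t ^ 2)
      (q * t ^ (q - 1) - κ * (2 * t)) t := by
    intro t
    have h1 : HasDerivAt (fun t : ℝ => t ^ q) (q * t ^ (q - 1)) t :=
      Real.hasDerivAt_rpow_const (Or.inr hq1)
    have h2 : HasDerivAt (fun t : ℝ => t ^ 2) (2 * t) t := by
      simpa using hasDerivAt_pow 2 t
    exact h1.sub (h2.const_mul κ)
  have hderiv : deriv (fun t : ℝ => t ^ q - κ * t ^ 2) = fun t => q * t ^ (q - 1) - κ * (2 * t) :=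
    funext fun t => (hd1 t).deriv
  have hd2 : ∀ t : ℝ, t ≠ 0 → HasDerivAt (fun t : ℝ => q * t ^ (q - 1) - κ * (2 * t))
      (q * ((q - 1) * t ^ (q - 2)) - κ * 2) t := by
    intro t ht
    have h1 : HasDerivAt (fun t : ℝ => t ^ (q - 1)) ((q - 1) * t ^ (q - 1 - 1)) t :=
      Real.hasDerivAt_rpow_const (Or.inl ht)
    rw [show q - 1 - 1 = q - 2 by ring] at h1
    have h2 : HasDerivAt (fun t : ℝ => 2 * t) 2 t := by
      simpa using (hasDerivAt_id t).const_mul 2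
    exact (h1.const_mul q).sub (h2.const_mul κ)
  refine convexOn_of_deriv2_nonneg (convex_Icc 0 R) ?_ ?_ ?_ ?_
  · exact fun t _ => (hd1 t).continuousAt.continuousWithinAt
  · exact fun t _ => (hd1 t).differentiableAt.differentiableWithinAt
  · rw [interior_Icc, hderiv]
    exact fun t ht => (hd2 t ht.1.ne').differentiableAt.differentiableWithinAt
  · rw [interior_Icc]
    intro t ht
    rw [Function.iterate_succ_apply, Function.iterate_one, hderiv, (hd2 t ht.1.ne').deriv]
    have hpow : R ^ (q - 2) ≤ t ^ (q - 2) :=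
      Real.rpow_le_rpow_of_nonpos ht.1 ht.2.le (by linarith)
    have hqq : 0 ≤ q * (q - 1) := mul_nonneg (by linarith) (by linarith)
    have hm := mul_le_mul_of_nonneg_left hpow hqq
    rw [hκ]
    nlinarith [hm]

/-- **Uniform midpoint strong convexity of `t ↦ t^q` on `[0, R]`** (`1 ≤ q ≤ 2`):
`2((s+t)/2)^q + (q(q−1)/4)·R^{q−2}·(s−t)² ≤ s^q + t^q` for `s, t ∈ [0, R]`. [folklore] -/
theorem rpow_midpoint_le {q R s t : ℝ} (hq1 : 1 ≤ q) (hq2 : q ≤ 2) (hs : s ∈ Icc 0 R)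
    (ht : t ∈ Icc 0 R) :
    2 * ((s + t) / 2) ^ q + q * (q - 1) / 4 * R ^ (q - 2) * (s - t) ^ 2 ≤ s ^ q + t ^ q := by
  have h := (convexOn_rpow_sub_sq hq1 hq2).2 hs ht (by norm_num : (0 : ℝ) ≤ 1 / 2)
    (by norm_num : (0 : ℝ) ≤ 1 / 2) (by norm_num)
  simp only [smul_eq_mul] at h
  have e : 1 / 2 * s + 1 / 2 * t = (s + t) / 2 := by ring
  rw [e] at h
  have e2 : q * (q - 1) / 4 * R ^ (q - 2) * (s - t) ^ 2 =
      q * (q - 1) / 2 * R ^ (q - 2) * (s ^ 2 + t ^ 2 - 2 * ((s + t) / 2) ^ 2) := by ring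
  rw [e2]
  linarith [h]

/-- **Outer gain.** For `1 ≤ q ≤ 2`, `0 ≤ u₀`, `a, b ∈ [0, R]` with `a + b ≥ 2u₀`:
`q·u₀^{q−1}·(a + b − 2u₀) + (q(q−1)/4)·R^{q−2}·(a − b)² ≤ a^q + b^q − 2u₀^q` (tangent line of
`t^q` at `u₀` evaluated at the midpoint `(a+b)/2`, and `rpow_midpoint_le`). [ours] -/
theorem rpow_secondDiff_ge {q R u₀ a b : ℝ} (hq1 : 1 ≤ q) (hq2 : q ≤ 2) (hu₀ : 0 ≤ u₀)
    (ha : a ∈ Icc 0 R) (hb : b ∈ Icc 0 R) (hD : 2 * u₀ ≤ a + b) :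
    q * u₀ ^ (q - 1) * (a + b - 2 * u₀) + q * (q - 1) / 4 * R ^ (q - 2) * (a - b) ^ 2 ≤
      a ^ q + b ^ q - 2 * u₀ ^ q := by
  have hm0 : 0 ≤ (a + b) / 2 := by linarith [ha.1, hb.1]
  have ht := rpow_tangent_le (p := q) hu₀ hm0 hq1
  have hmid := rpow_midpoint_le hq1 hq2 ha hb
  have e : (a + b) / 2 - u₀ = (a + b - 2 * u₀) / 2 := by ring
  rw [e] at ht
  linarith [ht, hmid]

/-- **`q`-th powers against squares.** For `1 ≤ q ≤ 2`, `0 < u₀ ≤ R`, `a, b ∈ [0, R]` with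
`a + b ≥ 2u₀` and `|a − u₀|, |b − u₀| ≤ L ≤ u₀`:
`(q(q−1)/6)·R^{q−2}·(a² + b² − 2u₀²) ≤ a^q + b^q − 2u₀^q`
(`a² + b² − 2u₀² = 2u₀D + D²/2 + (a−b)²/2 ≤ 3u₀D + (a−b)²/2`, `D = a + b − 2u₀ ∈ [0, 2L]`, and
`u₀^{q−1} ≥ R^{q−2}u₀`). [ours] -/
theorem rpow_secondDiff_ge_sq {q R u₀ a b L : ℝ} (hq1 : 1 ≤ q) (hq2 : q ≤ 2) (hu₀ : 0 < u₀)
    (hu₀R : u₀ ≤ R) (ha : a ∈ Icc 0 R) (hb : b ∈ Icc 0 R) (hD : 2 * u₀ ≤ a + b)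
    (haL : |a - u₀| ≤ L) (hbL : |b - u₀| ≤ L) (hL : L ≤ u₀) :
    q * (q - 1) / 6 * R ^ (q - 2) * (a ^ 2 + b ^ 2 - 2 * u₀ ^ 2) ≤ a ^ q + b ^ q - 2 * u₀ ^ q := by
  have hR : 0 < R := hu₀.trans_le hu₀R
  have hgain := rpow_secondDiff_ge hq1 hq2 hu₀.le ha hb hD
  have hpow : R ^ (q - 2) * u₀ ≤ u₀ ^ (q - 1) := by
    have h1 : R ^ (q - 2) ≤ u₀ ^ (q - 2) := Real.rpow_le_rpow_of_nonpos hu₀ hu₀R (by linarith)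
    have h2 : u₀ ^ (q - 1) = u₀ ^ (q - 2) * u₀ := by
      rw [show q - 1 = q - 2 + 1 by ring, Real.rpow_add hu₀, Real.rpow_one]
    rw [h2]
    exact mul_le_mul_of_nonneg_right h1 hu₀.le
  have hRq : 0 ≤ R ^ (q - 2) := Real.rpow_nonneg hR.le _
  have hqq : 0 ≤ q * (q - 1) := mul_nonneg (by linarith) (by linarith)
  have hD0 : 0 ≤ a + b - 2 * u₀ := by linarith
  have hDL : a + b - 2 * u₀ ≤ 2 * u₀ := by
    have h1 := (abs_le.1 haL).2
    have h2 := (abs_le.1 hbL).2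
    linarith
  have h3 : a ^ 2 + b ^ 2 - 2 * u₀ ^ 2 ≤ 3 * u₀ * (a + b - 2 * u₀) + (a - b) ^ 2 / 2 := by
    have hsq : a ^ 2 + b ^ 2 - 2 * u₀ ^ 2 =
        2 * u₀ * (a + b - 2 * u₀) + (a + b - 2 * u₀) ^ 2 / 2 + (a - b) ^ 2 / 2 := by ring
    have hDu : (a + b - 2 * u₀) ^ 2 ≤ 2 * u₀ * (a + b - 2 * u₀) := by
      rw [sq]; exact mul_le_mul_of_nonneg_right hDL hD0
    rw [hsq]; linarith
  have hTP : 0 ≤ q * (q - 1) / 6 * R ^ (q - 2) := by positivity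
  have h4 := mul_le_mul_of_nonneg_left h3 hTP
  have hM : 0 ≤ R ^ (q - 2) * u₀ * (a + b - 2 * u₀) := by positivity
  have hN : 0 ≤ R ^ (q - 2) * (a - b) ^ 2 := by positivity
  have h5 : q * (R ^ (q - 2) * u₀ * (a + b - 2 * u₀)) ≤ q * (u₀ ^ (q - 1) * (a + b - 2 * u₀)) :=
    mul_le_mul_of_nonneg_left (mul_le_mul_of_nonneg_right hpow hD0) (by linarith)
  have h6 : q * (q - 1) / 2 * (R ^ (q - 2) * u₀ * (a + b - 2 * u₀)) ≤
      q * (R ^ (q - 2) * u₀ * (a + b - 2 * u₀)) :=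
    mul_le_mul_of_nonneg_right (by nlinarith) hM
  have h7 : q * (q - 1) / 12 * (R ^ (q - 2) * (a - b) ^ 2) ≤
      q * (q - 1) / 4 * (R ^ (q - 2) * (a - b) ^ 2) :=
    mul_le_mul_of_nonneg_right (by nlinarith) hN
  have e4 : q * (q - 1) / 6 * R ^ (q - 2) * (3 * u₀ * (a + b - 2 * u₀) + (a - b) ^ 2 / 2) =
      q * (q - 1) / 2 * (R ^ (q - 2) * u₀ * (a + b - 2 * u₀)) +
        q * (q - 1) / 12 * (R ^ (q - 2) * (a - b) ^ 2) := by ring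
  have e5 : q * u₀ ^ (q - 1) * (a + b - 2 * u₀) + q * (q - 1) / 4 * R ^ (q - 2) * (a - b) ^ 2 =
      q * (u₀ ^ (q - 1) * (a + b - 2 * u₀)) + q * (q - 1) / 4 * (R ^ (q - 2) * (a - b) ^ 2) := by
    ring
  rw [e4] at h4
  rw [e5] at hgain
  linarith [h4, h5, h6, h7, hgain]

/-! ## 2. The second-difference floor of the core density for `1 ≤ q ≤ 2` -/

/-- `2λ(B) ≤ λ(B+X) + λ(B−X)` (midpoint convexity of the top Rayleigh value). [folklore] -/
theorem two_mul_lam_le (B X : Tens3) : 2 * lam B ≤ lam (B + X) + lam (B - X) := by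
  have h := lam_add_le (B + X) (B - X)
  have e : B + X + (B - X) = (2 : ℝ) • B := by module
  rw [e, lam_smul (by norm_num : (0 : ℝ) ≤ 2)] at h
  exact h

/-- `(‖B‖²)^{q/2−1} = ‖B‖^{q−2}` for `B ≠ 0`-free bookkeeping (`0 ≤ ‖B‖`). [bookkeeping] -/
theorem sq_rpow_half_sub_one (B : Tens3) (q : ℝ) : (‖B‖ ^ 2) ^ (q / 2 - 1) = ‖B‖ ^ (q - 2) := by
  rw [← Real.rpow_natCast, ← Real.rpow_mul (norm_nonneg B)]
  congr 1; push_cast; ring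

/-- `(6/7)·(‖B‖²)^{q/2−1} ≤ (‖B‖ + ‖X‖)^{q−2}` for `B ≠ 0`, `6‖X‖ ≤ ‖B‖`, `q ≤ 2`
(`‖B‖ + ‖X‖ ≤ (7/6)‖B‖` and `(7/6)^{q−2} ≥ (7/6)^{−1}`). [bookkeeping] -/
theorem rpow_radius_ge {q : ℝ} (hq1 : 1 ≤ q) (hq2 : q ≤ 2) {B X : Tens3} (hB0 : B ≠ 0)
    (hXB : 6 * ‖X‖ ≤ ‖B‖) : 6 / 7 * (‖B‖ ^ 2) ^ (q / 2 - 1) ≤ (‖B‖ + ‖X‖) ^ (q - 2) := by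
  have hBn : 0 < ‖B‖ := norm_pos_iff.mpr hB0
  have hR : 0 < ‖B‖ + ‖X‖ := by positivity
  have h1 : (7 / 6 * ‖B‖) ^ (q - 2) ≤ (‖B‖ + ‖X‖) ^ (q - 2) :=
    Real.rpow_le_rpow_of_nonpos hR (by linarith) (by linarith)
  have h2 : (7 / 6 * ‖B‖) ^ (q - 2) = (7 / 6 : ℝ) ^ (q - 2) * ‖B‖ ^ (q - 2) :=
    Real.mul_rpow (by norm_num) hBn.le
  have h3 : (6 / 7 : ℝ) ≤ (7 / 6 : ℝ) ^ (q - 2) := by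
    have h : (7 / 6 : ℝ) ^ (-1 : ℝ) ≤ (7 / 6 : ℝ) ^ (q - 2) :=
      Real.rpow_le_rpow_of_exponent_le (by norm_num) (by linarith)
    rw [Real.rpow_neg_one] at h
    exact le_trans (by norm_num) h
  rw [sq_rpow_half_sub_one]
  calc 6 / 7 * ‖B‖ ^ (q - 2) ≤ (7 / 6 : ℝ) ^ (q - 2) * ‖B‖ ^ (q - 2) :=
        mul_le_mul_of_nonneg_right h3 (Real.rpow_nonneg hBn.le _)
    _ = (7 / 6 * ‖B‖) ^ (q - 2) := h2.symm
    _ ≤ (‖B‖ + ‖X‖) ^ (q - 2) := h1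

/-- **One Rayleigh branch.** For symmetric trace-free `B ≠ 0`, `X` with `6‖X‖ ≤ ‖B‖` and
`1 ≤ q ≤ 2`: `(q(q−1)/6)·(‖B‖+‖X‖)^{q−2}·Δ²_X(λ²)(B) ≤ Δ²_X(λ^q)(B)` (`rpow_secondDiff_ge_sq` with
`u₀ = λ(B) ≥ ‖B‖/6 ≥ ‖X‖`, `R = ‖B‖ + ‖X‖`, the convexity and the `1`-Lipschitz bound of `λ`). [ours] -/
theorem lam_rpow_secondDiff_ge {q : ℝ} (hq1 : 1 ≤ q) (hq2 : q ≤ 2) {B X : Tens3} (hB : IsSymTF B)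
    (hX : IsSymTF X) (hXB : 6 * ‖X‖ ≤ ‖B‖) :
    q * (q - 1) / 6 * (‖B‖ + ‖X‖) ^ (q - 2) *
        (lam (B + X) ^ 2 + lam (B - X) ^ 2 - 2 * lam B ^ 2) ≤
      lam (B + X) ^ q + lam (B - X) ^ q - 2 * lam B ^ q := by
  by_cases hX0 : X = 0
  · subst hX0
    have e : lam (B + 0) ^ 2 + lam (B - 0) ^ 2 - 2 * lam B ^ 2 = 0 := by
      rw [add_zero, sub_zero]; ring
    rw [e, mul_zero, add_zero, sub_zero]
    linarith
  have hXn : 0 < ‖X‖ := norm_pos_iff.mpr hX0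
  have hu₀ : ‖B‖ ≤ 6 * lam B := norm_le_six_mul_lam hB.symm hB.tr
  have hu₀pos : 0 < lam B := by linarith
  have hLu : ‖X‖ ≤ lam B := by linarith
  have hu₀R : lam B ≤ ‖B‖ + ‖X‖ := (lam_le_norm B).trans (by linarith [norm_nonneg X])
  have ha : lam (B + X) ∈ Icc 0 (‖B‖ + ‖X‖) :=
    ⟨(hB.add hX).lam_nonneg, (lam_le_norm _).trans (norm_add_le B X)⟩
  have hb : lam (B - X) ∈ Icc 0 (‖B‖ + ‖X‖) :=
    ⟨(hB.sub hX).lam_nonneg, (lam_le_norm _).trans (norm_sub_le B X)⟩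
  have haL : |lam (B + X) - lam B| ≤ ‖X‖ := by
    have h := abs_lam_sub_lam_le (B + X) B
    rwa [add_sub_cancel_left] at h
  have hbL : |lam (B - X) - lam B| ≤ ‖X‖ := by
    have h := abs_lam_sub_lam_le (B - X) B
    rwa [show B - X - B = -X by abel, norm_neg] at h
  exact rpow_secondDiff_ge_sq hq1 hq2 hu₀pos hu₀R ha hb (two_mul_lam_le B X) haL hbL hLu

/-- **SECOND-DIFFERENCE FLOOR of the core density below two.** For symmetric trace-free `B ≠ 0`,
`X` with `6‖X‖ ≤ ‖B‖` and `1 ≤ q ≤ 2`: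
`(2q(q−1)/21)·(‖B‖²)^{q/2−1}·‖X‖² ≤ f_q(B+X) + f_q(B−X) − 2f_q(B)`
(both Rayleigh branches via `lam_rpow_secondDiff_ge`, the sum-of-squares floor
`secondDiff_sq_sum_ge` of `TopBotEigSplitFloor`, and `rpow_radius_ge`). [ours] -/
theorem coreDensity_secondDiff_ge_of_le_two {q : ℝ} (hq1 : 1 ≤ q) (hq2 : q ≤ 2) {B X : Tens3}
    (hB : IsSymTF B) (hX : IsSymTF X) (hB0 : B ≠ 0) (hXB : 6 * ‖X‖ ≤ ‖B‖) :
    2 * q * (q - 1) / 21 * (‖B‖ ^ 2) ^ (q / 2 - 1) * ‖X‖ ^ 2 ≤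
      coreDensity q (B + X) + coreDensity q (B - X) - 2 * coreDensity q B := by
  have hU := lam_rpow_secondDiff_ge hq1 hq2 hB hX hXB
  have hXB' : 6 * ‖-X‖ ≤ ‖-B‖ := by rwa [norm_neg, norm_neg]
  have hW := lam_rpow_secondDiff_ge hq1 hq2 hB.neg hX.neg hXB'
  rw [norm_neg, norm_neg, show -B + -X = -(B + X) by abel, show -B - -X = -(B - X) by abel] at hW
  have hsum := secondDiff_sq_sum_ge hB hX
  have hrad := rpow_radius_ge hq1 hq2 hB0 hXB
  have hqq : 0 ≤ q * (q - 1) := mul_nonneg (by linarith) (by linarith)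
  have hT : 0 ≤ (‖B‖ + ‖X‖) ^ (q - 2) := Real.rpow_nonneg (by positivity) _
  have h8 := mul_le_mul_of_nonneg_left hsum (mul_nonneg (div_nonneg hqq (by norm_num : (0:ℝ) ≤ 6)) hT)
  have h9 := mul_le_mul_of_nonneg_left hrad
    (mul_nonneg (div_nonneg hqq (by norm_num : (0:ℝ) ≤ 9)) (sq_nonneg ‖X‖))
  rw [coreDensity_eq (hB.add hX), coreDensity_eq (hB.sub hX), coreDensity_eq hB]
  have e1 : q * (q - 1) / 6 * (‖B‖ + ‖X‖) ^ (q - 2) *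
      (lam (B + X) ^ 2 + lam (-(B + X)) ^ 2 + (lam (B - X) ^ 2 + lam (-(B - X)) ^ 2) -
        2 * (lam B ^ 2 + lam (-B) ^ 2)) =
      q * (q - 1) / 6 * (‖B‖ + ‖X‖) ^ (q - 2) *
          (lam (B + X) ^ 2 + lam (B - X) ^ 2 - 2 * lam B ^ 2) +
        q * (q - 1) / 6 * (‖B‖ + ‖X‖) ^ (q - 2) *
          (lam (-(B + X)) ^ 2 + lam (-(B - X)) ^ 2 - 2 * lam (-B) ^ 2) := by ring
  have e2 : q * (q - 1) / 6 * (‖B‖ + ‖X‖) ^ (q - 2) * (2 / 3 * ‖X‖ ^ 2) =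
      q * (q - 1) / 9 * ‖X‖ ^ 2 * (‖B‖ + ‖X‖) ^ (q - 2) := by ring
  have e3 : q * (q - 1) / 9 * ‖X‖ ^ 2 * (6 / 7 * (‖B‖ ^ 2) ^ (q / 2 - 1)) =
      2 * q * (q - 1) / 21 * (‖B‖ ^ 2) ^ (q / 2 - 1) * ‖X‖ ^ 2 := by ring
  rw [e1, e2] at h8
  rw [e3] at h9
  linarith [hU, hW, h8, h9]

/-! ## 3. The second-difference ceiling of the norm density for `0 < q ≤ 2` -/

/-- **SECOND-DIFFERENCE CEILING of the norm density for `0 < q ≤ 2`** (every step `X`):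
`N(B+X) + N(B−X) − 2N(B) ≤ q·(‖B‖²)^{q/2−1}·‖X‖²` for `B ≠ 0` (concavity of `s ↦ s^{q/2}` on
`[0, ∞)` at `‖B±X‖²`, the parallelogram law, and Bernoulli's inequality). [ours] -/
theorem normDensity_secondDiff_le_of_le_two {q : ℝ} (hq0 : 0 < q) (hq2 : q ≤ 2) {B : Tens3}
    (hB0 : B ≠ 0) (X : Tens3) :
    normDensity q (B + X) + normDensity q (B - X) - 2 * normDensity q B ≤
      q * (‖B‖ ^ 2) ^ (q / 2 - 1) * ‖X‖ ^ 2 := by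
  unfold normDensity
  have hp0 : 0 < q / 2 := by linarith
  have hp1 : q / 2 ≤ 1 := by linarith
  have hBn : 0 < ‖B‖ := norm_pos_iff.mpr hB0
  have hm : 0 < ‖B‖ ^ 2 := by positivity
  have hab : ‖B + X‖ ^ 2 + ‖B - X‖ ^ 2 = 2 * (‖B‖ ^ 2 + ‖X‖ ^ 2) := by
    have h := parallelogram_law_with_norm ℝ B X
    linarith [h]
  have hconc := (Real.concaveOn_rpow hp0.le hp1).2
    (Set.mem_Ici.2 (by positivity : (0 : ℝ) ≤ ‖B + X‖ ^ 2))
    (Set.mem_Ici.2 (by positivity : (0 : ℝ) ≤ ‖B - X‖ ^ 2))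
    (by norm_num : (0 : ℝ) ≤ 1 / 2) (by norm_num : (0 : ℝ) ≤ 1 / 2) (by norm_num)
  simp only [smul_eq_mul] at hconc
  have e : 1 / 2 * ‖B + X‖ ^ 2 + 1 / 2 * ‖B - X‖ ^ 2 = ‖B‖ ^ 2 + ‖X‖ ^ 2 := by linarith
  rw [e] at hconc
  have hBer : (‖B‖ ^ 2 + ‖X‖ ^ 2) ^ (q / 2) ≤
      (‖B‖ ^ 2) ^ (q / 2) + q / 2 * (‖B‖ ^ 2) ^ (q / 2 - 1) * ‖X‖ ^ 2 := by
    have hs : (-1 : ℝ) ≤ ‖X‖ ^ 2 / ‖B‖ ^ 2 := by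
      have h : 0 ≤ ‖X‖ ^ 2 / ‖B‖ ^ 2 := by positivity
      linarith
    have h1 := rpow_one_add_le_one_add_mul_self hs hp0.le hp1
    have e2 : ‖B‖ ^ 2 + ‖X‖ ^ 2 = ‖B‖ ^ 2 * (1 + ‖X‖ ^ 2 / ‖B‖ ^ 2) := by
      field_simp
    have e3 : (‖B‖ ^ 2) ^ (q / 2) * (1 + q / 2 * (‖X‖ ^ 2 / ‖B‖ ^ 2)) =
        (‖B‖ ^ 2) ^ (q / 2) + q / 2 * (‖B‖ ^ 2) ^ (q / 2 - 1) * ‖X‖ ^ 2 := by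
      rw [Real.rpow_sub_one hm.ne']
      field_simp
    rw [e2, Real.mul_rpow hm.le (by positivity), ← e3]
    exact mul_le_mul_of_nonneg_left h1 (Real.rpow_nonneg hm.le _)
  linarith [hconc, hBer]

end TopEig

end Summit.NavierStokesRegularity.FunctionalMining
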